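import Literature.Computability.MetaComplexity.CuttingPlanesDag
import Literature.Computability.MetaComplexity.Resolution
import HarnessLib

/-!
# Cutting planes p-simulates resolution (Cook–Coullard–Turán 1987)

Cook–Coullard–Turán's Proposition (1987, §2; Krajíček 2019, Lemma 6.3.1): every resolution
refutation `π` (with weakening, `Resolution.lean`) of a CNF `φ` of width `w = resWidth π`
translates into a cutting planes refutation with at most `|π| (4 w + 2)` lines, all of
`ℓ¹`-norm at most `8 (w + 1)` — small coefficients (`cuttingPlanes_simulates_resolution`).
A clause `C` becomes the inequality `∑_{l ∈ C} l ≥ 1` (`CPSim.ofFClause`); a resolution step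
`C ∨ x, D ∨ ¬x ⊢ C ∨ D` becomes: add the two inequalities (the `x` and `1 - x` cancel to `1`,
which moves to the right: `∑_C l + ∑_D l ≥ 1`), add the bounds `l ≥ 0` for the literals
occurring in exactly one of `C, D` (so that every literal of `C ∪ D` has coefficient `2`), and
DIVIDE by `2` with rounding, `⌈1/2⌉ = 1`; a weakening adds bounds `l ≥ 0`.  The construction is
dag-like (every translated clause is cited by later steps) and is assembled with `CPTreeH`
(`CuttingPlanesDag.lean`).  With `CuttingPlanesPigeonhole.lean` (polynomial-size `CP`
refutations of `PHP`, exponential for resolution by Haken's theorem) this places resolution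
STRICTLY below cutting planes with small coefficients.

## References

* W. Cook, C. R. Coullard, Gy. Turán, Discrete Appl. Math. 18 (1987), §2 (Proposition:
  cutting planes simulate resolution) [CookCoullardTuran1987].
* J. Krajíček, *Proof complexity* (CUP 2019), §6.3 [KrajicekProofComplexity2019].
-/

namespace Literature.Computability.MetaComplexity

open Finset Literature.Computability.Complexity CPLine
open scoped symmDiff

namespace CPSim

variable {ν : Type*} [DecidableEq ν]

/-! ### Coefficient mass (generic variables) -/

/-- The coefficient `ℓ¹`-mass `∑_v |f v|`. [folklore] -/
noncomputable def mass (f : ν →₀ ℤ) : ℕ := f.sum fun _ a => a.natAbs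

omit [DecidableEq ν] in
/-- The norm of a line is `|b| +` the mass of its coefficients (definitional). [folklore] -/
theorem norm_eq (L : CPLine ν) : L.norm = L.const.natAbs + mass L.coeff := rfl

omit [DecidableEq ν] in
/-- Mass as a sum over any finset containing the support. [folklore] -/
theorem mass_eq_sum {f : ν →₀ ℤ} {T : Finset ν} (h : f.support ⊆ T) : mass f = ∑ v ∈ T, (f v).natAbs := by
  unfold mass Finsupp.sum
  exact Finset.sum_subset h fun v _ hv => by rw [Finsupp.notMem_support_iff.1 hv]; rfl

/-- Mass is subadditive. [folklore] -/
theorem mass_add_le (f g : ν →₀ ℤ) : mass (f + g) ≤ mass f + mass g := by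
  have hT : (f + g).support ⊆ f.support ∪ g.support := Finsupp.support_add
  rw [mass_eq_sum hT, mass_eq_sum (Finset.subset_union_left (s₁ := f.support) (s₂ := g.support)),
    mass_eq_sum (Finset.subset_union_right (s₁ := f.support) (s₂ := g.support)), ← Finset.sum_add_distrib]
  exact Finset.sum_le_sum fun v _ => Int.natAbs_add_le _ _

omit [DecidableEq ν] in
/-- Mass of a natural multiple. [folklore] -/
theorem mass_nsmul_le (c : ℕ) (f : ν →₀ ℤ) : mass (c • f) ≤ c * mass f := by
  rw [mass_eq_sum (Finsupp.support_smul (b := c) (g := f)), mass, Finsupp.sum, Finset.mul_sum]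
  refine Finset.sum_le_sum fun v _ => ?_
  rw [Finsupp.smul_apply, nsmul_eq_mul, Int.natAbs_mul, Int.natAbs_natCast]

omit [DecidableEq ν] in
/-- Mass of a literal's coefficient vector is `1`. [folklore] -/
theorem mass_litCoeff (l : Literal ν) : mass (litCoeff l) = 1 := by
  unfold mass litCoeff
  rw [Finsupp.sum_single_index (by rfl)]
  split_ifs <;> rfl

/-- Mass of a sum of literal coefficient vectors is at most the number of literals. [folklore] -/
theorem mass_sum_litCoeff_le (C : Finset (Literal ν)) : mass (∑ l ∈ C, litCoeff l) ≤ C.card := by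
  induction C using Finset.induction_on with
  | empty => simp [mass]
  | insert l C hl ih =>
    rw [Finset.sum_insert hl, Finset.card_insert_of_notMem hl]
    refine (mass_add_le _ _).trans ?_
    rw [mass_litCoeff]; omega

/-! ### Clauses as lines, literal bounds -/

/-- The inequality of a set-clause `C`: `∑_{positive} x - ∑_{negative} x ≥ 1 - #negative`
(`ofClause` of `CuttingPlanes.lean` is `ofFClause` of the clause's `toFinset`).
[cite: CookCoullardTuran1987, §2] -/
noncomputable def ofFClause (C : Finset (Literal ν)) : CPLine ν :=
  ⟨∑ l ∈ C, litCoeff l, 1 - ((C.filter fun l => l.2 = false).card : ℤ)⟩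

omit [DecidableEq ν] in
/-- `ofClause C = ofFClause C.toFinset` (definitional). [folklore] -/
theorem ofClause_eq_ofFClause [DecidableEq ν] (C : Clause ν) : ofClause C = ofFClause C.toFinset := rfl

/-- The number of negative literals of a set-clause. [folklore] -/
def negCount (C : Finset (Literal ν)) : ℕ := (C.filter fun l => l.2 = false).card

/-- The bound `l ≥ 0` of a literal: `x ≥ 0` for positive, `-x ≥ -1` (i.e. `1 - x ≥ 0`) for
negative `l`. [cite: CookCoullardTuran1987, §2] -/
noncomputable def litBound (l : Literal ν) : CPLine ν := ⟨litCoeff l, if l.2 then 0 else -1⟩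

omit [DecidableEq ν] in
/-- A positive literal's bound is the lower-bound axiom. [folklore] -/
theorem litBound_pos (v : ν) : litBound ((v, true) : Literal ν) = lower v := by
  simp [litBound, litCoeff, lower]

omit [DecidableEq ν] in
/-- A negative literal's bound is the upper-bound axiom. [folklore] -/
theorem litBound_neg (v : ν) : litBound ((v, false) : Literal ν) = upper v := by
  simp [litBound, litCoeff, upper]

/-- `negCount` of an insertion. [folklore] -/
theorem negCount_insert {C : Finset (Literal ν)} {l : Literal ν} (hl : l ∉ C) :
    (negCount (insert l C) : ℤ) = negCount C + (if l.2 then 0 else 1) := by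
  unfold negCount
  rw [Finset.filter_insert]
  by_cases hb : l.2 = false
  · rw [if_pos hb, Finset.card_insert_of_notMem (fun h' => hl (Finset.mem_filter.1 h').1), hb]
    push_cast; simp
  · have ht : l.2 = true := by cases h : l.2 <;> simp_all
    rw [if_neg hb, ht]
    simp

/-- **Weakening by one literal**: `ofFClause (insert l C) = ofFClause C + (l ≥ 0)` for
`l ∉ C`. [cite: CookCoullardTuran1987, §2] -/
theorem ofFClause_insert {C : Finset (Literal ν)} {l : Literal ν} (hl : l ∉ C) :
    ofFClause (insert l C) = ofFClause C + litBound l := by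
  show ofFClause (insert l C) = ⟨(ofFClause C).coeff + litCoeff l, (ofFClause C).const + (if l.2 then 0 else -1)⟩
  unfold ofFClause
  congr 1
  · rw [Finset.sum_insert hl, add_comm]
  · have := negCount_insert hl
    unfold negCount at this
    rw [this]
    split_ifs <;> ring

omit [DecidableEq ν] in
/-- The empty clause is the contradiction `0 ≥ 1`. [folklore] -/
theorem ofFClause_empty : ofFClause (∅ : Finset (Literal ν)) = ⟨0, 1⟩ := by
  simp [ofFClause]

/-- Norm of a clause line: `≤ 2 #C + 1`. [folklore] -/
theorem norm_ofFClause_le (C : Finset (Literal ν)) : (ofFClause C).norm ≤ 2 * C.card + 1 := by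
  rw [norm_eq]
  unfold ofFClause
  have h1 := mass_sum_litCoeff_le C
  have h2 : ((C.filter fun l => l.2 = false).card : ℤ) ≤ C.card := by
    exact_mod_cast Finset.card_filter_le _ _
  have h3 : (1 - ((C.filter fun l => l.2 = false).card : ℤ)).natAbs ≤ C.card + 1 := by omega
  simp only at h1 ⊢
  omega

omit [DecidableEq ν] in
/-- Norm of a literal bound: `≤ 2`. [folklore] -/
theorem norm_litBound_le (l : Literal ν) : (litBound l).norm ≤ 2 := by
  rw [norm_eq]
  unfold litBound
  rw [mass_litCoeff]
  split_ifs <;> simp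

/-! ### The resolution step -/

section Step

variable (A B : Finset (Literal ν))

/-- The intermediate line of a simulated resolution step after adding the bounds of the
literals in `T`: `∑_A l + ∑_B l + ∑_T l ≥ 1`. [cite: CookCoullardTuran1987, §2] -/
noncomputable def mid (T : Finset (Literal ν)) : CPLine ν :=
  ⟨∑ l ∈ A, litCoeff l + ∑ l ∈ B, litCoeff l + ∑ l ∈ T, litCoeff l,
    1 - (negCount A : ℤ) - negCount B - negCount T⟩

/-- The doubled clause line `∑_{A ∪ B} 2 l ≥ 1`. [cite: CookCoullardTuran1987, §2] -/
noncomputable def dbl : CPLine ν :=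
  ⟨2 • ∑ l ∈ A ∪ B, litCoeff l, 1 - 2 * (negCount (A ∪ B) : ℤ)⟩

variable {A B}

/-- **Adding the two premises**: `ofFClause (A + x) + ofFClause (B + ¬x) = mid ∅` — the pivot
cancels to the constant `1`. [cite: CookCoullardTuran1987, §2] -/
theorem ofFClause_add_ofFClause {v : ν} (hA : (v, true) ∉ A) (hB : (v, false) ∉ B) :
    ofFClause (insert (v, true) A) + ofFClause (insert (v, false) B) = mid A B ∅ := by
  rw [ofFClause_insert hA, ofFClause_insert hB]
  show (⟨((ofFClause A).coeff + litCoeff (v, true)) + ((ofFClause B).coeff + litCoeff (v, false)),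
      ((ofFClause A).const + (if true then 0 else -1)) + ((ofFClause B).const + (if false then 0 else -1))⟩
    : CPLine ν) = mid A B ∅
  unfold ofFClause mid negCount litCoeff
  simp only [↓reduceIte, Bool.false_eq_true, Finset.sum_empty, add_zero, Finset.filter_empty,
    Finset.card_empty, Nat.cast_zero, sub_zero]
  congr 1
  · have h : Finsupp.single v (1 : ℤ) + Finsupp.single v (-1) = 0 := by
      rw [← Finsupp.single_add]; simp
    calc (∑ l ∈ A, Finsupp.single l.1 (if l.2 = true then (1 : ℤ) else -1)) + Finsupp.single v 1 +
          ((∑ l ∈ B, Finsupp.single l.1 (if l.2 = true then (1 : ℤ) else -1)) + Finsupp.single v (-1))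
        = (∑ l ∈ A, Finsupp.single l.1 (if l.2 = true then (1 : ℤ) else -1)) +
            (∑ l ∈ B, Finsupp.single l.1 (if l.2 = true then (1 : ℤ) else -1)) +
            (Finsupp.single v 1 + Finsupp.single v (-1)) := by abel
      _ = _ := by rw [h, add_zero]
  · ring

/-- **Adding one more bound**: `mid T + (l ≥ 0) = mid (insert l T)` for `l ∉ T`.
[cite: CookCoullardTuran1987, §2] -/
theorem mid_insert {T : Finset (Literal ν)} {l : Literal ν} (hl : l ∉ T) :
    mid A B (insert l T) = mid A B T + litBound l := by
  show mid A B (insert l T) = ⟨(mid A B T).coeff + litCoeff l, (mid A B T).const + (if l.2 then 0 else -1)⟩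
  unfold mid
  congr 1
  · rw [Finset.sum_insert hl]
    simp only [add_comm, add_left_comm, add_assoc]
  · rw [negCount_insert hl]; split_ifs <;> ring

/-- **All bounds added**: with `T = A ∆ B`, every literal of `A ∪ B` has coefficient `2`:
`mid (A ∆ B) = dbl`. [cite: CookCoullardTuran1987, §2] -/
theorem mid_symmDiff : mid A B (A ∆ B) = dbl A B := by
  unfold mid dbl
  have hdisj : Disjoint (A ∆ B) (A ∩ B) := by
    rw [Finset.disjoint_left]
    intro l hl hl'
    rw [Finset.mem_symmDiff] at hl
    rw [Finset.mem_inter] at hl'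
    tauto
  have hunion : A ∆ B ∪ A ∩ B = A ∪ B := by
    ext l; simp only [Finset.mem_union, Finset.mem_symmDiff, Finset.mem_inter]; tauto
  congr 1
  · have h1 := Finset.sum_union_inter (s₁ := A) (s₂ := B) (f := fun l : Literal ν => litCoeff l)
    have h2 : ∑ l ∈ A ∆ B, litCoeff l + ∑ l ∈ A ∩ B, litCoeff l = ∑ l ∈ A ∪ B, litCoeff l := by
      rw [← Finset.sum_union hdisj, hunion]
    rw [two_smul, ← h1, add_assoc, add_comm (∑ l ∈ A ∩ B, litCoeff l) (∑ l ∈ A ∆ B, litCoeff l), h2]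
  · unfold negCount
    have h1 := Finset.card_union_add_card_inter (A.filter fun l => l.2 = false) (B.filter fun l => l.2 = false)
    rw [← Finset.filter_union, ← Finset.filter_inter_distrib] at h1
    have h2 : ((A ∆ B).filter fun l => l.2 = false).card + ((A ∩ B).filter fun l => l.2 = false).card =
        ((A ∪ B).filter fun l => l.2 = false).card := by
      rw [← Finset.card_union_of_disjoint (Finset.disjoint_filter_filter hdisj), ← Finset.filter_union, hunion]
    zify at h1 h2
    linarith

/-- **The division**: `dbl / 2 = ofFClause (A ∪ B)`, since `⌈(1 - 2N)/2⌉ = 1 - N`.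
[cite: CookCoullardTuran1987, §2] -/
theorem divBy_dbl : divBy 2 (dbl A B) = ofFClause (A ∪ B) := by
  unfold divBy dbl ofFClause negCount
  congr 1
  · ext v
    simp only [Finsupp.mapRange_apply, Finsupp.coe_smul, Pi.smul_apply, nsmul_eq_mul, Nat.cast_ofNat]
    rw [Int.mul_ediv_cancel_left _ (by norm_num)]
  · unfold ceilDiv
    set N : ℤ := (((A ∪ B).filter fun l => l.2 = false).card : ℤ)
    have h : -(1 - 2 * N) = 1 + 2 * (N - 1) := by ring
    rw [h, Nat.cast_ofNat, Int.add_mul_ediv_left _ _ (by norm_num)]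
    norm_num

/-- Divisibility of the doubled line by `2`. [folklore] -/
theorem dvd_coeff_dbl (v : ν) : (2 : ℤ) ∣ (dbl A B).coeff v := by
  unfold dbl
  simp only [Finsupp.coe_smul, Pi.smul_apply, nsmul_eq_mul, Nat.cast_ofNat]
  exact dvd_mul_right _ _

/-- Norm of an intermediate line (`T ⊆ A ∆ B`): `≤ 8 w + 3` when `#A, #B ≤ w`. [folklore] -/
theorem norm_mid_le {T : Finset (Literal ν)} (hT : T ⊆ A ∆ B) {w : ℕ} (hA : A.card ≤ w) (hB : B.card ≤ w) :
    (mid A B T).norm ≤ 8 * w + 3 := by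
  rw [norm_eq]
  unfold mid negCount
  have hTc : T.card ≤ 2 * w :=
    (Finset.card_le_card hT).trans ((Finset.card_le_card (Finset.symmDiff_subset_union (s := A) (t := B))).trans
      ((Finset.card_union_le _ _).trans (by omega)))
  have hm : mass (∑ l ∈ A, litCoeff l + ∑ l ∈ B, litCoeff l + ∑ l ∈ T, litCoeff l) ≤ 4 * w :=
    ((mass_add_le _ _).trans (Nat.add_le_add ((mass_add_le _ _).trans (Nat.add_le_add (mass_sum_litCoeff_le A)
      (mass_sum_litCoeff_le B))) (mass_sum_litCoeff_le T))).trans (by omega)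
  have h1 : ((A.filter fun l => l.2 = false).card : ℤ) ≤ w := by exact_mod_cast (Finset.card_filter_le _ _).trans hA
  have h2 : ((B.filter fun l => l.2 = false).card : ℤ) ≤ w := by exact_mod_cast (Finset.card_filter_le _ _).trans hB
  have h3 : ((T.filter fun l => l.2 = false).card : ℤ) ≤ 2 * w := by exact_mod_cast (Finset.card_filter_le _ _).trans hTc
  have hc : (1 - ((A.filter fun l => l.2 = false).card : ℤ) - ((B.filter fun l => l.2 = false).card : ℤ) -
      ((T.filter fun l => l.2 = false).card : ℤ)).natAbs ≤ 4 * w + 1 := by omega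
  simp only at hm ⊢
  omega

/-- Norm of the doubled line: `≤ 8 w + 1` when `#(A ∪ B) ≤ w`… here from `#A, #B ≤ w`.
[folklore] -/
theorem norm_dbl_le {w : ℕ} (hA : A.card ≤ w) (hB : B.card ≤ w) : (dbl A B).norm ≤ 8 * w + 1 := by
  rw [norm_eq]
  unfold dbl negCount
  have hU : (A ∪ B).card ≤ 2 * w := (Finset.card_union_le _ _).trans (by omega)
  have hm : mass (2 • ∑ l ∈ A ∪ B, litCoeff l) ≤ 4 * w :=
    ((mass_nsmul_le 2 _).trans (Nat.mul_le_mul_left _ (mass_sum_litCoeff_le _))).trans (by omega)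
  have h1 : (((A ∪ B).filter fun l => l.2 = false).card : ℤ) ≤ 2 * w := by
    exact_mod_cast (Finset.card_filter_le _ _).trans hU
  have hc : (1 - 2 * (((A ∪ B).filter fun l => l.2 = false).card : ℤ)).natAbs ≤ 4 * w + 1 := by omega
  simp only at hm ⊢
  omega

end Step

/-! ### The trees of the three rules -/

section Trees

variable {φ : CNF ν} {W : ℕ} {D : List (CPStep ν)}

/-- The bound of a literal as a one-line tree. [folklore] -/
theorem treeH_litBound (l : Literal ν) (hW : 2 ≤ W) : CPTreeH φ W D (litBound l) 1 := by
  obtain ⟨v, b⟩ := l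
  cases b
  · rw [litBound_neg]
    exact CPTreeH.upper v ((litBound_neg v) ▸ (norm_litBound_le (v, false)).trans hW)
  · rw [litBound_pos]
    exact CPTreeH.lower v ((litBound_pos v) ▸ (norm_litBound_le (v, true)).trans hW)

/-- **Weakening as a tree**: from a cited line `ofFClause C`, adding the bounds of new
literals one by one derives `ofFClause (C ∪ T)` with `2 #T` new lines (`T ∩ C = ∅`,
`#(C ∪ T) ≤ w`, `W = 8 (w + 1)`). [cite: CookCoullardTuran1987, §2] -/
theorem treeH_weaken {idx : ℕ} (hidx : idx < D.length) {C : Finset (Literal ν)}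
    (hC : (D[idx]'hidx).line = ofFClause C) {w : ℕ} (hW : W = 8 * (w + 1)) :
    ∀ T : Finset (Literal ν), Disjoint T C → (C ∪ T).card ≤ w → CPTreeH φ W D (ofFClause (C ∪ T)) (2 * T.card) := by
  intro T
  induction T using Finset.induction_on with
  | empty =>
    intro _ _
    rw [Finset.union_empty, Finset.card_empty, Nat.mul_zero, ← hC]
    exact CPTreeH.hyp idx hidx
  | insert l T hl ih =>
    intro hdisj hcard
    have hlC : l ∉ C := Finset.disjoint_left.1 hdisj (Finset.mem_insert_self l T)
    have hdisj' : Disjoint T C := Finset.disjoint_of_subset_left (Finset.subset_insert l T) hdisj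
    have hcard' : (C ∪ T).card ≤ w := (Finset.card_le_card (Finset.union_subset_union le_rfl
      (Finset.subset_insert l T))).trans hcard
    have h1 := ih hdisj' hcard'
    have hlCT : l ∉ C ∪ T := by rw [Finset.mem_union]; tauto
    have heq : ofFClause (C ∪ insert l T) = ofFClause (C ∪ T) + litBound l := by
      rw [Finset.union_insert, ofFClause_insert hlCT]
    have h := CPTreeH.add h1 (treeH_litBound l (by omega)) (by
      rw [← heq]; exact (norm_ofFClause_le _).trans (by rw [hW]; omega))
    rw [← heq] at h
    exact h.of_eq_of_eq rfl (by rw [Finset.card_insert_of_notMem hl]; ring)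

/-- **The resolution step as a tree**: from cited lines `ofFClause (A + x)` and
`ofFClause (B + ¬x)`, the clause line `ofFClause (A ∪ B)` in `2 + 2 #(A ∆ B)` new lines
(`#A + 1, #B + 1 ≤ w`, `W = 8 (w + 1)`). [cite: CookCoullardTuran1987, §2] -/
theorem treeH_resolve {i j : ℕ} (hi : i < D.length) (hj : j < D.length) {A B : Finset (Literal ν)} {v : ν}
    (hvA : (v, true) ∉ A) (hvB : (v, false) ∉ B)
    (hCi : (D[i]'hi).line = ofFClause (insert (v, true) A)) (hCj : (D[j]'hj).line = ofFClause (insert (v, false) B))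
    {w : ℕ} (hA : A.card + 1 ≤ w) (hB : B.card + 1 ≤ w) (hW : W = 8 * (w + 1)) :
    CPTreeH φ W D (ofFClause (A ∪ B)) (2 + 2 * (A ∆ B).card) := by
  -- the intermediate lines
  have hmid : ∀ T : Finset (Literal ν), T ⊆ A ∆ B → CPTreeH φ W D (mid A B T) (1 + 2 * T.card) := by
    intro T
    induction T using Finset.induction_on with
    | empty =>
      intro _
      have h := CPTreeH.add (CPTreeH.hyp (φ := φ) (W := W) (pre := D) i hi) (CPTreeH.hyp j hj) (by
        rw [hCi, hCj, ofFClause_add_ofFClause hvA hvB]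
        exact (norm_mid_le (w := w) (Finset.empty_subset _) (by omega) (by omega)).trans (by rw [hW]; omega))
      rw [hCi, hCj, ofFClause_add_ofFClause hvA hvB] at h
      exact h
    | insert l T hl ih =>
      intro hsub
      have h1 := ih ((Finset.subset_insert l T).trans hsub)
      have h := CPTreeH.add h1 (treeH_litBound l (by omega)) (by
        rw [← mid_insert hl]; exact (norm_mid_le (w := w) hsub (by omega) (by omega)).trans (by rw [hW]; omega))
      rw [← mid_insert hl] at h
      exact h.of_eq_of_eq rfl (by rw [Finset.card_insert_of_notMem hl]; ring)
  have hd := hmid (A ∆ B) le_rfl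
  rw [mid_symmDiff] at hd
  have h := CPTreeH.div 2 two_pos (dvd_coeff_dbl (A := A) (B := B)) hd (by
    rw [divBy_dbl]
    refine (norm_ofFClause_le _).trans ?_
    have := Finset.card_union_le A B
    rw [hW]; omega)
  rw [divBy_dbl] at h
  exact h.of_eq_of_eq rfl (by ring)

end Trees

end CPSim

open CPSim

/-! ### The simulation -/

/-- Every clause of a refutation has at most `resWidth` literals. [folklore] -/
theorem card_clause_le_resWidth {ν : Type*} {π : List (ResLine ν)} {k : ℕ} (hk : k < π.length) :
    (π[k]'hk).clause.card ≤ resWidth π := by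
  unfold resWidth
  have hmem : (π[k]'hk).clause.card ∈ π.map fun l => l.clause.card := List.mem_map.2 ⟨_, List.getElem_mem hk, rfl⟩
  revert hmem
  generalize π.map (fun l => l.clause.card) = L
  intro hmem
  induction L with
  | nil => simp at hmem
  | cons b L ih =>
    rw [List.foldr_cons]
    rcases List.mem_cons.1 hmem with h | h
    · rw [← h]; exact le_max_left _ _
    · exact (ih h).trans (le_max_right _ _)

/-- **Cutting planes p-simulates resolution** (Cook–Coullard–Turán 1987, §2, Proposition;
Krajíček 2019, Lemma 6.3.1): a resolution refutation `π` of `φ` of width `w = resWidth π`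
yields a cutting planes refutation of `φ` with at most `|π| (4 w + 2)` lines, all of
`ℓ¹`-norm at most `8 (w + 1)`. [cite: CookCoullardTuran1987, §2] -/
theorem cuttingPlanes_simulates_resolution {ν : Type*} [DecidableEq ν] {φ : CNF ν}
    {π : List (ResLine ν)} (hπ : IsResRefutation φ π) :
    ∃ π' : List (CPStep ν), IsCPRefutation φ π' ∧
      π'.length ≤ π.length * (4 * resWidth π + 2) ∧ cpNorm π' ≤ 8 * (resWidth π + 1) := by
  classical
  obtain ⟨hder, l₀, hl₀, hempty⟩ := hπ
  set w := resWidth π with hw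
  set W := 8 * (w + 1) with hW
  -- the dag construction, line by line
  have main : ∀ k, k ≤ π.length → ∃ D : List (CPStep ν), IsCPDerivation φ D ∧
      (∀ st ∈ D, st.line.norm ≤ W) ∧ D.length ≤ k * (4 * w + 2) ∧
      ∀ i (hi : i < k) (hik : i < π.length), ∃ idx, ∃ hidx : idx < D.length,
        (D[idx]'hidx).line = ofFClause (π[i]'hik).clause := by
    intro k
    induction k with
    | zero =>
      intro _
      exact ⟨[], isCPDerivation_nil φ, fun _ h => by simp at h, by simp, fun i hi => absurd hi (Nat.not_lt_zero _)⟩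
    | succ k ih =>
      intro hk
      obtain ⟨D, hD, hDn, hDlen, hlook⟩ := ih (Nat.le_of_succ_le hk)
      have hkπ : k < π.length := hk
      have hval := hder k hkπ
      have htk : (π.take k).length = k := by simp; omega
      -- a tree with `≤ 4w + 2` new lines deriving the translated clause of line `k`
      have htree : ∃ s, s ≤ 4 * w + 2 ∧ CPTreeH φ W D (ofFClause (π[k]'hkπ).clause) s := by
        unfold IsValidResLine at hval
        rcases hr : (π[k]'hkπ).rule with _ | ⟨i, j, v⟩ | i <;> rw [hr] at hval
        · -- initial clause
          unfold CNF.clauseFinsets at hval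
          obtain ⟨Cl, hCl, hCleq⟩ := List.mem_map.1 hval
          refine ⟨1, by omega, ?_⟩
          have h := CPTreeH.initial (φ := φ) (W := W) (pre := D) hCl (by
            rw [ofClause_eq_ofFClause, hCleq]
            exact (norm_ofFClause_le _).trans (by have := card_clause_le_resWidth hkπ; rw [hW]; omega))
          rw [ofClause_eq_ofFClause, hCleq] at h
          exact h
        · -- resolution step
          obtain ⟨hi, hj, hres⟩ := hval
          rw [htk] at hi hj
          rw [List.getElem_take, List.getElem_take] at hres
          obtain ⟨hvi, hvj, hE⟩ := hres
          obtain ⟨ii, hii, hDi⟩ := hlook i hi (hi.trans hkπ)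
          obtain ⟨jj, hjj, hDj⟩ := hlook j hj (hj.trans hkπ)
          set A := (π[i]'(hi.trans hkπ)).clause.erase (v, true) with hA
          set B := (π[j]'(hj.trans hkπ)).clause.erase (v, false) with hB
          have hAi : insert (v, true) A = (π[i]'(hi.trans hkπ)).clause := Finset.insert_erase hvi
          have hBj : insert (v, false) B = (π[j]'(hj.trans hkπ)).clause := Finset.insert_erase hvj
          have hAc : A.card + 1 ≤ w := by
            rw [hA, Finset.card_erase_of_mem hvi]
            have h1 := card_clause_le_resWidth (hi.trans hkπ)
            have h2 : 0 < (π[i]'(hi.trans hkπ)).clause.card := Finset.card_pos.2 ⟨_, hvi⟩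
            omega
          have hBc : B.card + 1 ≤ w := by
            rw [hB, Finset.card_erase_of_mem hvj]
            have h1 := card_clause_le_resWidth (hj.trans hkπ)
            have h2 : 0 < (π[j]'(hj.trans hkπ)).clause.card := Finset.card_pos.2 ⟨_, hvj⟩
            omega
          have h := treeH_resolve (φ := φ) hii hjj (Finset.notMem_erase _ _) (Finset.notMem_erase _ _)
            (by rw [hDi, hAi]) (by rw [hDj, hBj]) hAc hBc hW
          refine ⟨2 + 2 * (A ∆ B).card, ?_, by rw [hE]; exact h⟩
          have := (Finset.card_le_card (Finset.symmDiff_subset_union (s := A) (t := B))).trans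
            (Finset.card_union_le A B)
          omega
        · -- weakening
          obtain ⟨hi, hsub⟩ := hval
          rw [htk] at hi
          rw [List.getElem_take] at hsub
          obtain ⟨ii, hii, hDi⟩ := hlook i hi (hi.trans hkπ)
          set C := (π[i]'(hi.trans hkπ)).clause with hC
          set C' := (π[k]'hkπ).clause with hC'
          have hunion : C ∪ (C' \ C) = C' := Finset.union_sdiff_of_subset hsub
          have h := treeH_weaken (φ := φ) hii hDi hW (C' \ C) Finset.sdiff_disjoint
            (by rw [hunion]; exact card_clause_le_resWidth hkπ)
          rw [hunion] at h
          refine ⟨2 * (C' \ C).card, ?_, h⟩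
          have := (Finset.card_le_card (Finset.sdiff_subset (s := C') (t := C))).trans (card_clause_le_resWidth hkπ)
          omega
      obtain ⟨s, hs, ht⟩ := htree
      obtain ⟨ext, hlen, hD', hDn', idx, hidx, hline⟩ := ht.extend hD hDn
      refine ⟨D ++ ext, hD', hDn', by rw [List.length_append, hlen, Nat.succ_mul]; omega, fun i hi hik => ?_⟩
      rcases Nat.lt_succ_iff_lt_or_eq.1 hi with h | rfl
      · obtain ⟨idx', hidx', hl'⟩ := hlook i h hik
        exact ⟨idx', by rw [List.length_append]; omega, by rw [List.getElem_append_left hidx']; exact hl'⟩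
      · exact ⟨idx, hidx, hline⟩
  obtain ⟨D, hD, hDn, hDlen, hlook⟩ := main π.length le_rfl
  obtain ⟨e, he, rfl⟩ := List.mem_iff_getElem.1 hl₀
  obtain ⟨idx, hidx, hline⟩ := hlook e he he
  rw [hempty, ofFClause_empty] at hline
  exact ⟨D, ⟨hD, D[idx]'hidx, List.getElem_mem hidx, by rw [hline]; exact ⟨rfl, one_pos⟩⟩, hDlen,
    cpNorm_le_of_forall hDn⟩

end Literature.Computability.MetaComplexity
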